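import Literature.NumberTheory.EllipticCurves.Wan2015RationalMainConjecture
import HarnessLib

/-!
# Skinner–Urban 2014, Theorem 1 (= Thm. 3.6.4), RATIONAL part — instance: a good-ordinary
# higher-weight member `g` of the Hida family `H(E[p])` of an elliptic curve with `p ∥ N`, `p` ODD,
# `E[p]` irreducible, whose level has a prime `q ∥ M` at which `E` is ADDITIVE (named fact, D-0014)

HONEST FRAMING (prover seat bsd-line-er5-p2, width seat of the line on crux stmt-BirchSwinnertonDyer-19064
`X11aLowerHalf`, `p = 3` stub; cell home `run/shared/lean/pub/bsd-stepL/line-er5-p2/`): this file vendors ONE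
printed theorem (its rational part only) as a named fact (`def … : Prop`, nothing asserted, no `_holds`), as an
INSTANCE typed in EXACTLY the vocabulary and dictionary of the audited Wan instance
`Wan2015.thm4_rational_weightK_member_of_bdd_ofLevel_irred` (`Wan2015RationalMainConjecture.lean`; cell
`b2b-bsdres` audit X11A-AUDIT (b), review of p204620, lit g34 audit of p608784): same member predicate
`IsOrdinaryMemberOfLevel`, same ordinary `p`-adic data `OrdinaryPadicData`, same Greenberg–Selmer dual data,
same bounded cyclotomic `p`-adic `L`-function `IsCycPAdicLFunctionWeightK`, same conclusion block
(`L = c · (u · G)`, `c ≠ 0`, `u ∈ Λ_𝒪ˣ`). What differs from that instance: the prime binder is `p ≠ 2` (S–U: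
"Let `p` be an odd prime", §1.1) instead of Wan's `5 ≤ p`, and S–U's auxiliary hypothesis (ram) is ADDED, in
the curve's language (below). The tree's GENERIC typing of the same theorem is
`SkinnerUrban2014.thm1_charIdeal_eq_padicLFunction_rational` (`GL2MainConjecture.lean`, `3 ≤ p`, vocabulary
`OrdinaryNewformDatum`); this instance exists only because the consumer — the odd-prime Hida-family chain of
crux `X11aLowerHalf` (`Summits/…/Theorems/PrintX11aLowerHalfOddPrimeChain.lean`, predicate
`OddChain.RatEqAtMember`) — is typed in the `OrdinaryPadicData` vocabulary of the EPW ∕ Wan instances, for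
which the tree has no bridge to `OrdinaryNewformDatum`.

## Source, verbatim (C. Skinner, E. Urban, Invent. Math. 195 (2014); author version
`paper:doi-10-1007-s00222-013-0448-1`, the pagination of `GL2MainConjecture.lean`)

* §1.1, p. 1, l. 8: "Let `p` be an odd prime."
* Theorem 1 (= Thm. 3.6.4), p. 2, ll. 34–44: "Suppose • `χ = 1` and `k ≡ 2 mod p − 1`; • the reduction
  `ρ̄_f` of `ρ_f` modulo the maximal ideal of `𝒪_L` is irreducible; • there exists a prime `q ≠ p` such that
  `q ‖ N` and `ρ̄_f` is ramified at `q`; • `p ∤ N`. Then `Ch_{ℚ_∞,L}(f) = (𝓛_f)` in `Λ_{ℚ,𝒪_L} ⊗_{ℤ_p} ℚ_p`."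
  (the integral refinement under an `SL₂(ℤ_p)`-image hypothesis is NOT vendored); Thm. 3.6.4 (p. 43):
  "for any set of primes `Σ`, `Ch^Σ_{ℚ_∞,L}(f) = (𝓛^Σ_f)` in `Λ_{ℚ,𝒪_L} ⊗_{ℤ_p} ℚ_p`" under (irred), (dist)
  (automatic for `χ = 1`, `p ∤ N`, `k ≡ 2 (mod p − 1)`: on inertia the characters are `1` and `ω⁻¹`), (ram),
  `p ∤ N_f`; Thm. 3.3.7 (p. 30): the dual Selmer groups are `Λ`-torsion (Kato).
* `Ch_{ℚ_∞,L}(f)` = characteristic ideal of the `Λ_{𝒪_L}`-dual of S–U's Selmer group of `f` over `ℚ_∞`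
  (§3.1.3, p. 18) = Greenberg's `Sel(ℚ_∞, A_f)` over `ℚ_∞` (reading as in `GL2MainConjecture.lean` (ii), flag
  `SU14-Sel-Dp-vs-Ip`; the same identification the Wan instance makes: "Wan's `char^Σ_{ℚ_∞,L}` (SU14 §3
  Greenberg Selmer group) = EPW's `L^alg`"); `𝓛_f` = the cyclotomic `p`-adic `L`-function of `f` w.r.t.
  S–U's canonical period — the tree's bounded `L` of `IsCycPAdicLFunctionWeightK` (Shimura period datum) is
  `c₀ · 𝓛_f`, `c₀ ≠ 0`, whence the constant `c` in the conclusion (flag `SU14-period-constant-c`).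

## The instance, and its faithfulness

`E/ℚ` globally minimal, `p ≠ 2`, `p ‖ N` (multiplicative), `E[p]` irreducible; `M` with `p ∤ M`; `(g, ι)` an
ordinary member of `H(E[p])` of level `M` (`IsOrdinaryMemberOfLevel W p g ι`: `g ∈ S_k(Γ₀(M))` a newform,
`k > 2`, `k ≡ 2 (mod p − 1)`, `|ι a_p(g)|_p = 1`, `|ι a_ℓ(g) − a_ℓ(E)|_p < 1` for all `ℓ ∤ N`); `f :=` the
ordinary `p`-stabilisation of `g`; AND a prime `q` with `q ≠ p`, `q ∣ M`, `q² ∤ M` and `q² ∣ N` (i.e. `E` has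
ADDITIVE reduction at `q`, `W` being globally minimal). Printed hypotheses: `p` odd ✓; `χ = 1` ✓ (`Γ₀(M)`);
`k ≡ 2 (mod p − 1)`, `k ≥ 2` ✓; `p ∤ N_f = M` ✓; `p`-ordinary ✓; (irred) ✓ — `ρ̄_f = ρ̄_{g,ι} ≅ E[p]` (the
congruences at all `ℓ ∤ NM` + Brauer–Nesbitt + Chebotarev; `E[p]` irreducible); (dist) ✓ (automatic, above);
(ram) ✓ — `q ‖ M = N_f`, and `ρ̄_f ≅ E[p]` IS RAMIFIED AT `q`: `E` has additive reduction at `q ∤ p` and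
`p ≥ 3`, so inertia at `q` acts non-trivially on `E[p]` (Serre–Tate ∕ Néron–Ogg–Shafarevich with the
torsion-freeness of `ker(GL₂(ℤ_p) → GL₂(𝔽_p))` for `p ≥ 3`; in the tree:
`WeierstrassCurve.exists_smul_geomTorsion_ne_of_hasAdditiveReductionAt`, file
`AdditiveReductionRamifiedTorsionProofs.lean`, Silverman AEC VII.6.1 ∕ ATAEC IV.10.2 (a)). Conclusion as typed
(VERBATIM the Wan instance's): for every cyclotomic `(κ, γ)` with `IsCyclotomicVariable`, every TORSION
`Λ_𝒪`-dual datum `D` of Greenberg's Selmer group of the member with a generator `G` of `charIdeal(D)`, every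
Shimura datum `Dsym` and THE bounded cyclotomic `p`-adic `L`-function `L` of `(g, ι, υ)`: `L = c · (u · G)`,
`c ∈ ℚ̄_pˣ`, `u ∈ Λ_𝒪ˣ` — which is "`Ch_{ℚ_∞,L}(f) = (𝓛_f)` in `Λ_{ℚ,𝒪_L} ⊗ ℚ_p`" (units of `Λ_𝒪 ⊗ ℚ_p` are
`π^ℤ · Λ_𝒪ˣ`; any generator of a principal ideal of the domain `Λ_𝒪` is a unit multiple of any other; the
constant is allowed in `ℚ̄_pˣ ⊇ Lˣ`, a harmless weakening). Torsion-ness of `D` is a HYPOTHESIS here (as in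
the Wan instance; the consumer gets it from EPW Thm. 3.1.1), although S–U's Thm. 3.3.7 also asserts it.
ONLY THE RATIONAL EQUALITY IS VENDORED. Named fact; nothing asserted; no `_holds`.

## Flags carried (referee records on this source; see `GL2MainConjecture.lean` for the full text)

`SU14-Thm1-rational-only`, `SU14-Sel-Dp-vs-Ip`, `SU14-period-constant-c` (informational); and on the PROOF:
`SU14-12.3.6-mu@nonsplit` — informational at `p ≥ 5` — and **`SU14-12.3.6-mu@nonsplit@3`, graded
ACTIVE-PRINT-GAP by the cell referee (R152.2, 2026-08-21) AT `p = 3`**: in the proof of Thm. 3.6.4 the (ram)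
prime `q` is chosen inert in the auxiliary imaginary quadratic field, its Euler factor `(q² − 1)/q²` in
(12.3.5.b) is never a `3`-adic unit, so the appeal to [Va03] for the `μ`-invariant (Prop. 12.3.6) cannot be
made as printed in any `p = 3` instance; Wan's refereed repair (Forum Math. Sigma 3 (2015), Lemma 87,
Thm. 101, Thm. 103) is stated under "`p ≥ 5`"; no refereed repair at `p = 3` located. THIS INSTANCE IS
CONSUMED AT `p = 3` (crux `X11aLowerHalf`, stub `stub_lowerThreeDeep`): every consumer inherits the `@3`
flag and must display it. The statement typed below is the theorem AS PRINTED (refereed, Invent. Math.);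
nothing here asserts it.
-- TODO(general form): S–U's (ram) allows any prime `q ‖ N_f` at which `ρ̄_f` is ramified (for `E[p]`:
-- also a multiplicative `q` of `E` with `p ∤ v_q(Δ)`); any `Σ`; weight-`2` members (`k = 2`); nebentypus
-- (Cor. 3.6.2–3.6.3); the INTEGRAL equality under the `SL₂(ℤ_p)`-image hypothesis — none vendored here.

References: [SkinnerUrban2014] §1.1 (p. 1), Thm. 1 (p. 2) = Thm. 3.6.4 (p. 43), §3.1.3 (p. 18), §3.3.4–3.3.7
(pp. 29–30), Prop. 12.3.6 (p. 202); [Wan2015] p. 4, Lemma 87, Thm. 101, Thm. 103 (the `p ≥ 5` repair);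
[Skinner2016PacificMC] §2.5; [EmertonPollackWeston2006] Intro p. 2 (`H(ρ̄)`: members of every tame level);
[SilvermanAEC2009] Thm. VII.6.1 (additive ⇒ `E[p]` ramified, `p ≥ 3`); cell files
`pub/bsd-stepL/line-er5-p2/P3-LOWER-AUDIT.md` (census: the instance's hypothesis at `p = 3` on X11a).
-/

noncomputable section

open scoped Classical MatrixGroups ModularForm

open NumberField IsDedekindDomain Field CongruenceSubgroup
open Literature.NumberTheory.GaloisRepresentations
open Literature.NumberTheory.EllipticCurves.ModularForms

namespace Literature.NumberTheory.EllipticCurves.SkinnerUrban2014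

/-- **C. Skinner, E. Urban, Invent. Math. 195 (2014), Theorem 1 (p. 2) = Thm. 3.6.4 (p. 43), RATIONAL
part — instance: an ordinary weight-`k` member `(g, ι)` of the Hida family `H(E[p])` of an elliptic curve
`E/ℚ` with `p ‖ N`, `p` ODD, `E[p]` IRREDUCIBLE, of a level `M` (`p ∤ M`) having a prime `q ‖ M`, `q ≠ p`,
with `q² ∣ N` (additive reduction of `E` at `q`).** Printed statement (verbatim): "Suppose • `χ = 1` and
`k ≡ 2 mod p − 1`; • the reduction `ρ̄_f` of `ρ_f` modulo the maximal ideal of `𝒪_L` is irreducible;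
• there exists a prime `q ≠ p` such that `q ‖ N` and `ρ̄_f` is ramified at `q`; • `p ∤ N`. Then
`Ch_{ℚ_∞,L}(f) = (𝓛_f)` in `Λ_{ℚ,𝒪_L} ⊗_{ℤ_p} ℚ_p`" (`p` an odd prime, §1.1; `f` a `p`-ordinary newform of
weight `k ≥ 2`). Typed EXACTLY as the Wan instance `Wan2015.thm4_rational_weightK_member_of_bdd_ofLevel_irred`
(same dictionary: `Ch_{ℚ_∞,L}(f)` = the `Λ_𝒪`-dual of Greenberg's `Sel(ℚ_∞, A_g)`, `GreenbergSelmer.DualData`;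
`𝓛_f` = THE bounded cyclotomic `p`-adic `L`-function of `(g, ι, υ)` up to a non-zero constant,
`IsCycPAdicLFunctionWeightK` + boundedness; conclusion `L = c · (u · G)`, `c ∈ ℚ̄_pˣ`, `u ∈ Λ_𝒪ˣ`; `Σ = ∅`),
with the prime binder `p ≠ 2` and ONE hypothesis added — S–U's (ram) for `f`, in the form `q ≠ p`, `q ∣ M`,
`q² ∤ M`, `q² ∣ N`. Discharge of the printed hypotheses on the instance: `p` odd ✓; `χ = 1` ✓; `k ≡ 2
(mod p − 1)`, `k ≥ 2` ✓ (`IsOrdinaryMemberOfLevel`); `p ∤ N_f = M` ✓; ordinary ✓ (`|ι a_p(g)|_p = 1`); (irred)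
✓ (`ρ̄_f ≅ E[p]` irreducible); (dist) ✓ (automatic: inertia characters `1`, `ω⁻¹`); (ram) ✓ — `q ‖ M` and
`ρ̄_f ≅ E[p]` is ramified at the additive prime `q ∤ p` of `E` because `p ≥ 3` (Silverman AEC VII.6.1 ∕
ATAEC IV.10.2 (a); tree theorem `WeierstrassCurve.exists_smul_geomTorsion_ne_of_hasAdditiveReductionAt`).
Flags: `SU14-Thm1-rational-only`, `SU14-Sel-Dp-vs-Ip`, `SU14-period-constant-c`, `SU14-12.3.6-mu@nonsplit`
(informational) and **`SU14-12.3.6-mu@nonsplit@3` = ACTIVE-PRINT-GAP at `p = 3`** (cell referee R152.2; the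
module docstring) — THIS INSTANCE IS MEANT FOR `p = 3` and every consumer must carry that flag. ONLY THE
RATIONAL EQUALITY IS VENDORED. Named fact; nothing asserted; no `_holds`.
-- TODO(general form): (ram) at any `q ‖ N_f` with `ρ̄_f` ramified; any `Σ`; `k = 2`; the integral
-- refinement; see `SkinnerUrban2014.thm1_charIdeal_eq_padicLFunction_rational` for the generic typing.
[cite: SkinnerUrban2014, §1.1 (p. 1), Thm. 1 (p. 2) = Thm. 3.6.4 (p. 43), §3.1.3 (p. 18), §3.3.4–3.3.7 (pp. 29–30)]
[cite: Wan2015, p. 4 and Lemma 87, Thm. 101, Thm. 103 (pp. 71, 88–92) (the p ≥ 5 repair of Prop. 12.3.6)]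
[cite: EmertonPollackWeston2006, Intro p. 2 (H(ρ̄): members of every tame level) (arXiv:math/0404484 p. 2)]
[cite: SilvermanAEC2009, Thm. VII.6.1 and proof of VII.7.1 (additive reduction: inertia moves a p-torsion point, p ≥ 3)] -/
def thm364_rational_weightK_member_of_bdd_ofLevel_ram : Prop :=
  ∀ (W : WeierstrassCurve ℚ) [W.IsElliptic] [W.IsGloballyMinimal] (p : ℕ) [Fact p.Prime],
    p ≠ 2 → W.HasMultiplicativeReductionAtPrime p → W.HasIrreducibleModPGaloisRep p →
    ∀ {M : ℕ} [NeZero M], ¬ p ∣ M →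
    -- (ram) for the member: a prime `q ‖ M`, `q ≠ p`, at which `E` is additive (`q² ∣ N`)
    (∃ q : ℕ, q.Prime ∧ q ≠ p ∧ q ∣ M ∧ ¬ q ^ 2 ∣ M ∧ q ^ 2 ∣ W.conductorNorm ℤ) →
    ∀ {k : ℤ} (g : CuspForm (Gamma0 M) k)
      (ι : coeffField g →+* PadicAlgCl p), IsOrdinaryMemberOfLevel W p g ι →
    ∀ (𝔇 : OrdinaryPadicData g p ι) (κ : ZpExtension ℚ p) (γ : Field.absoluteGaloisGroup ℚ),
      κ.IsCyclotomic → κ.IsTopGenerator γ → IsCyclotomicVariable p γ →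
    ∀ (D : GreenbergSelmer.DualData (padicCoeffField (memberGenerators g ι 𝔇.υ)) κ γ 𝔇.ρ 𝔇.plus),
      Module.IsTorsion (PowerSeries (padicCoeffIntegers (memberGenerators g ι 𝔇.υ))) D.X →
    ∀ G : PowerSeries (padicCoeffIntegers (memberGenerators g ι 𝔇.υ)),
      D.charIdeal = Ideal.span {G} →
    ∀ (Dsym : PeriodSymbolDatum g) (L : PowerSeries (PadicAlgCl p)),
      IsCycPAdicLFunctionWeightK g Dsym p ι 𝔇.υ L →
      (∃ C : ℝ, ∀ i, ‖PowerSeries.coeff i L‖ ≤ C) →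
      ∃ (c : PadicAlgCl p) (u : (PowerSeries (padicCoeffIntegers (memberGenerators g ι 𝔇.υ)))ˣ),
        c ≠ 0 ∧
          L = PowerSeries.C c *
            PowerSeries.map (padicCoeffIntegers (memberGenerators g ι 𝔇.υ)).subtype
              ((u : PowerSeries (padicCoeffIntegers (memberGenerators g ι 𝔇.υ))) * G)

end Literature.NumberTheory.EllipticCurves.SkinnerUrban2014

end
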